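import Mathlib
import HarnessLib
import Literature.MathematicalPhysics.QuantumLattice.GrassmannWeightedEffectiveActionBiGradedMap
import Literature.MathematicalPhysics.QuantumLattice.HubbardSectorFieldSubstitution
import Summits.HubbardSuperconductivity.HubbardSuperconductivity.Theorems.KLProgrammeKLRegimeEngineScaleZeroE4GridVertex
import Summits.HubbardSuperconductivity.HubbardSuperconductivity.Theorems.KLProgrammeKLRegimeEngineScaleZeroNorms

/-!
# K3 engine child (`KLRegimeEngineV14`, stmt-HubbardSuperconductivity-19918), stub `stub_engine_scale0`, clause (E4)₀ `EngineFirstMoments … 0`: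
# the first space-time moment of the scale-`0` sectorised quartic kernel from ONE decay-weighted bi-graded determinant-bounded step

Cell gate-hubbard-kl, seat hubbard-kl-k3c2-p1 (row «scale-0 Gram step `stub_engine_scale0`»).  Clause (E4)₀ of the scale-`0` rung asks, for
every label 4-tuple `Ω` and legs `i, k`,
`ε_x³ · Σ_x spaceTimeDist(x_i, x_k) · ‖klAnisoLegKernel … klE0 0 4 Ω (0, x)‖ ≤ (G.cE4 + Q.cE4|U|)·Klam·|U|`.
As (E1-v4)₀ (`…ScaleZeroNorms`: ONE degree-graded determinant-bounded Gaussian step of the grid vertex `V_N + 𝒩_{K,N}` on the `N = 4M` time grid,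
read through the sector analysis map), this file ASSEMBLES the first moment from the DECAY-WEIGHTED BI-GRADED step
(`GrassmannWeightedEffectiveActionBiGradedMap.sum_wt_norm_kernel_map_effAction_le_biquartic_of_gramBounded`) with the tree weight
`wt = gridLabelWt L (4M) β = 1 + diam` of `…ScaleZeroE4Defs` (positions `gridLegPos` / `latticeLegPos`), leaving THREE weighted sizes as hypotheses:

1. (α_w) the `wt`-pair-weighted row / column sums of the pulled-back scale-`0` covariance `Sᵀ C^K_{>e₀} S` (first space-time moment of the UV
   propagator on the grid — `…ScaleZeroE4Alpha*`, via `HubbardGridCharacters` and the product-torus moment Plancherel);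
2. (cr_w / cc_w) the same for the cross-grid overlap kernel `E₀ S` of the scale-`0` multiplier family (`…ScaleZeroE4Overlap*`);
3. the smallness `θ_w = e·α_w·‖Ṽ‖_{h,wt}/κ² < 1` for the `wt`-weighted pinned profile of the grid vertex, which is EXPLICIT here:
   `N_w(2) = |U||β|/N` (the quartic grid vertex is ultralocal: `wt = 1` on its support, `sum_norm_kernel_hubbardGridInteraction_mul_wt_le`) and
   `N_w(1) = (|β|/N)·Σ_z ‖Ǩ_L(z)‖·(1 + |z|_{ℓ^∞})` (the counterterm is time-local: `sum_norm_kernel_hubbardGridCounterQuadratic_mul_wt_le`; its moment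
   is p3's `sum_abs_mul_norm_framePosKernel_le_of_frameOK`, consumed downstream).

* (part 1, `…ScaleZeroE4GridVertex`: the weighted profile `sum_norm_kernel_gridVertex_mul_wt_le`);
* `klAnisoLegKernel_zero_eq_kernel_map` — the scale-`0` sectorised kernel IS a kernel of `map (toLin' E₀) (effAction C^K_{>e₀} (map (toLin' S) (V_N + 𝒩_{K,N})))`;
* **`firstMoment_zero_le_of_wgridStep`** — for every `Ω`, `i`, `k`:
  `ε_x³·Σ_x spaceTimeDist(x_i,x_k)·‖klAnisoLegKernel … 0 4 Ω (0,x)‖ ≤ ε_x³ · cr_w · cc_w³ · (ρ⁻⁴ · e·f₂ / (1 - θ_w)²)`, `f₂ = (e²(κ+ρ))⁴·|U||β|/N` —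
  LINEAR in `|U|` whatever the weighted size of the counterterm (bi-grading: four legs need one quartic vertex).

Everything is proved; no definitions, no named facts, no sorry.
-/

noncomputable section

namespace Summit.HubbardSuperconductivity.HubbardSuperconductivity.Theorems.EngineV8

set_option linter.dupNamespace false -- summit = problem name (single-conjunct summit), D-0017

open Real Finset Literature.MathematicalPhysics.QuantumLattice Literature.Probability.LatticeModels
open Literature.Probability.LatticeModels.BattleFederbush
open Literature.MathematicalPhysics.QuantumLattice.GrassmannAlgebra
open Summit.HubbardSuperconductivity.HubbardSuperconductivity.Theorems.KLRegimeSplit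
open Summit.HubbardSuperconductivity.HubbardSuperconductivity.Theorems.DispersionFlow
open Summit.HubbardSuperconductivity.HubbardSuperconductivity.Theorems.KLProgrammeLegKernels

variable {L M : ℕ} [NeZero L]

/-! ## §3 The assembly: the first moment of the scale-`0` sectorised quartic kernel -/

/-- **The scale-`0` sectorised kernel is a kernel of the analysed Gaussian step of the substituted grid vertex**:
`klAnisoLegKernel … klE0 0 m Ω X = kernel (map (toLin' E₀) (effAction C^K_{>e₀} (map (toLin' S) (V_N + 𝒩_{K,N})))) m (j ↦ (X j, Ω j))`. -/
theorem klAnisoLegKernel_zero_eq_kernel_map [NeZero M] {β : ℝ} (hβ : β ≠ 0) (U μ : ℝ) (K : TrigPolyC4v) (m : ℕ)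
    (Ω : Fin m → SectorLeg (sectorCount 0)) (X : Fin m → SpaceTimeIdx L M) :
    klAnisoLegKernel L M β U μ K klE0 0 m Ω X =
      kernel ℂ (ExteriorAlgebra.map (Matrix.toLin' (sectorAnalysisMatrix L M β (klAnisoFamily L M β μ K klE0 0)))
        (effAction ℂ (hubbardCovAboveCT L M β μ 0 K klE0)
          (ExteriorAlgebra.map (Matrix.toLin' (hubbardGridSub L M β (2 * (2 * M))))
            (hubbardGridInteraction L (2 * (2 * M)) β U + hubbardGridCounterQuadratic L (2 * (2 * M)) β K)))) m
        (fun j => (X j, Ω j)) := by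
  rw [klAnisoLegKernel, klEffectiveAction_zero_eq_effAction_map hβ U μ K, kernel_map_sectorAnalysis]

/-- **(E4)₀'s first moment from ONE decay-weighted bi-graded determinant-bounded step** (stub `stub_engine_scale0`, clause (E4)₀, modulo the
three weighted sizes).  `S = hubbardGridSub … (4M)`, `C₀ = C^K_{>e₀}`, `E₀ = sectorAnalysisMatrix β (klAnisoFamily … klE0 0)`, `wt = gridLabelWt L (4M) β`:
if `SᵀC₀S` is replica-Gram-bounded (`κ`) with `wt`-pair-weighted row / column sums `≤ α_w`, `θ_w = e·α_w·‖Ṽ‖_{h,wt}/κ² < 1` for the weighted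
profile of the grid vertex and a weight `ρ > 0`, and `E₀S` has `wt`-pair-weighted row / column sums `≤ cr_w / cc_w`, then for every label
4-tuple `Ω` and legs `i, k`:
`ε_x³·Σ_x spaceTimeDist(x_i, x_k)·‖klAnisoLegKernel … klE0 0 4 Ω (0, x)‖ ≤ ε_x³·cr_w·cc_w³·(ρ⁻⁴·e f₂·(eα_w f₂/κ²)⁰/(1-θ_w)²)`,
`f₂ = (e²(κ+ρ))⁴·|U||β|/(4M)` — linear in `|U|`. -/
theorem firstMoment_zero_le_of_wgridStep [NeZero M] {β : ℝ} (hβ : 0 < β) (U μ : ℝ) (K : TrigPolyC4v)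
    {κ : ℝ} (hκ : 0 < κ)
    (hGB : IsGramBoundedR ((hubbardGridSub L M β (2 * (2 * M))).transpose * hubbardCovAboveCT L M β μ 0 K klE0 *
      hubbardGridSub L M β (2 * (2 * M))) κ)
    {αw : ℝ} (hαw : 0 < αw)
    (hrow : ∀ X, ∑ Y, ‖((hubbardGridSub L M β (2 * (2 * M))).transpose * hubbardCovAboveCT L M β μ 0 K klE0 *
      hubbardGridSub L M β (2 * (2 * M))) X Y‖ * gridLabelWt L (2 * (2 * M)) β {gridLegPos X, gridLegPos Y} ≤ αw)
    (hcol : ∀ Y, ∑ X, ‖((hubbardGridSub L M β (2 * (2 * M))).transpose * hubbardCovAboveCT L M β μ 0 K klE0 *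
      hubbardGridSub L M β (2 * (2 * M))) X Y‖ * gridLabelWt L (2 * (2 * M)) β {gridLegPos X, gridLegPos Y} ≤ αw)
    {ρ : ℝ} (hρ : 0 < ρ)
    (hθ : Real.exp 1 * αw * normV (GridLeg (GridPoint L (2 * (2 * M)))) κ ρ
      (fun m' : ℕ => if m' = 1 then |β| / (2 * (2 * M) : ℕ) * ∑ z : TorusSite 2 L, ‖framePosKernel L K z‖ * (1 + torusSiteDist z 0)
        else if m' = 2 then |U| * |β| / (2 * (2 * M) : ℕ) else 0) / κ ^ 2 < 1)
    {crw ccw : ℝ} (hccw0 : 0 ≤ ccw)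
    (hrow' : ∀ X'' : SpaceTimeIdx L M × SectorLeg (sectorCount 0), ∑ X' : GridLeg (GridPoint L (2 * (2 * M))),
      ‖(sectorAnalysisMatrix L M β (klAnisoFamily L M β μ K klE0 0) * hubbardGridSub L M β (2 * (2 * M))) X'' X'‖ *
        gridLabelWt L (2 * (2 * M)) β {latticeLegPos (2 * (2 * M)) X'', gridLegPos X'} ≤ crw)
    (hcol' : ∀ X' : GridLeg (GridPoint L (2 * (2 * M))), ∑ X'' : SpaceTimeIdx L M × SectorLeg (sectorCount 0),
      ‖(sectorAnalysisMatrix L M β (klAnisoFamily L M β μ K klE0 0) * hubbardGridSub L M β (2 * (2 * M))) X'' X'‖ *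
        gridLabelWt L (2 * (2 * M)) β {latticeLegPos (2 * (2 * M)) X'', gridLegPos X'} ≤ ccw)
    (Ω : Fin 4 → SectorLeg (sectorCount 0)) (i k : Fin 4) :
    imagTimeWeight β M ^ 3 *
        ∑ x : Fin 3 → SpaceTimeIdx L M,
          KLRegimeSplit.spaceTimeDist L M β (Matrix.vecCons (0 : SpaceTimeIdx L M) x i) (Matrix.vecCons (0 : SpaceTimeIdx L M) x k) *
            ‖klAnisoLegKernel L M β U μ K klE0 0 4 Ω (Matrix.vecCons (0 : SpaceTimeIdx L M) x)‖ ≤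
      imagTimeWeight β M ^ 3 *
        (crw * ccw ^ (2 * 2 - 1) *
          (ρ⁻¹ ^ (2 * 2) * (Real.exp 1 * ((Real.exp 2 * (κ + ρ)) ^ (2 * 2) * (|U| * |β| / (2 * (2 * M) : ℕ)))) *
            (Real.exp 1 * αw * ((Real.exp 2 * (κ + ρ)) ^ (2 * 2) * (|U| * |β| / (2 * (2 * M) : ℕ))) / κ ^ 2) ^ (2 - 2) /
              (1 - Real.exp 1 * αw * normV (GridLeg (GridPoint L (2 * (2 * M)))) κ ρ
                (fun m' : ℕ => if m' = 1 then |β| / (2 * (2 * M) : ℕ) * ∑ z : TorusSite 2 L, ‖framePosKernel L K z‖ * (1 + torusSiteDist z 0)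
                  else if m' = 2 then |U| * |β| / (2 * (2 * M) : ℕ) else 0) / κ ^ 2) ^ 2)) := by
  -- notation
  set Ng : ℕ := 2 * (2 * M) with hNg
  haveI : NeZero Ng := ⟨by rw [hNg]; have := NeZero.ne M; omega⟩
  set S := hubbardGridSub L M β Ng with hS
  set C₀ := hubbardCovAboveCT L M β μ 0 K klE0 with hC₀
  set F₀ := klAnisoFamily L M β μ K klE0 0 with hF₀
  set E₀ := sectorAnalysisMatrix L M β F₀ with hE₀
  set Vt := hubbardGridInteraction L Ng β U + hubbardGridCounterQuadratic L Ng β K with hVt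
  set wt := gridLabelWt L Ng β with hwt
  set Nw : ℕ → ℝ := fun m' : ℕ => if m' = 1 then |β| / Ng * ∑ z : TorusSite 2 L, ‖framePosKernel L K z‖ * (1 + torusSiteDist z 0)
    else if m' = 2 then |U| * |β| / Ng else 0 with hNw
  have hwtree : IsTreeWeight wt := isTreeWeight_gridLabelWt L Ng hβ.le
  have hfS : LinearMap.toMatrix' (Matrix.toLin' S) = S := LinearMap.toMatrix'_toLin' S
  have hgE : LinearMap.toMatrix' (Matrix.toLin' E₀) = E₀ := LinearMap.toMatrix'_toLin' E₀
  have hVt_even : Vt ∈ evenPart ℂ (GridLeg (GridPoint L Ng)) :=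
    add_mem (hubbardGridInteraction_mem_evenPart β U) (hubbardGridCounterQuadratic_mem_evenPart β K)
  have hVt0 : constPart ℂ Vt = 0 := by
    rw [hVt, map_add, constPart_hubbardGridInteraction, constPart_hubbardGridCounterQuadratic, add_zero]
  have hNw2 : ∀ m', 2 < m' → Nw m' = 0 := fun m' hm' => by
    rw [hNw]; dsimp only; rw [if_neg (by omega), if_neg (by omega)]
  -- (1) the weighted bi-graded step, output degree `4`, leg `0` pinned at `(0, Ω 0)`
  have hstep := (sum_wt_norm_kernel_map_effAction_le_biquartic_of_gramBounded hwtree gridLegPos (latticeLegPos Ng) C₀ (Matrix.toLin' S)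
    (Matrix.toLin' E₀) Vt hVt_even hVt0 Nw (scaleZeroPinnedW_nonneg β U K)
    (fun m' j w => sum_norm_kernel_gridVertex_mul_wt_le β U hβ.le K m' j w) hNw2 hκ (by rw [hfS]; exact hGB) hαw
    (by rw [hfS]; exact hrow) (by rw [hfS]; exact hcol) hρ hθ hccw0
    (fun X'' => by rw [hfS, hgE]; exact hrow' X'') (fun X' => by rw [hfS, hgE]; exact hcol' X') (p := 2) le_rfl
    (⟨0, by omega⟩ : Fin (2 * 2)) ((0 : SpaceTimeIdx L M), Ω 0)).2
  -- (2) the first-moment sum is dominated by the weighted pinned sum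
  set Φ : (Fin 3 → SpaceTimeIdx L M) → (Fin (2 * 2) → SpaceTimeIdx L M × SectorLeg (sectorCount 0)) :=
    fun x j => (Matrix.vecCons (0 : SpaceTimeIdx L M) x j, Ω j) with hΦ
  have hΦinj : Function.Injective Φ := by
    intro x x' h
    funext j
    have hj := congrFun h j.succ
    rw [hΦ] at hj
    simpa using (Prod.ext_iff.1 hj).1
  have hΦmem : ∀ x, Φ x ∈ univ.filter (fun X'' : Fin (2 * 2) → SpaceTimeIdx L M × SectorLeg (sectorCount 0) =>
      X'' (⟨0, by omega⟩ : Fin (2 * 2)) = ((0 : SpaceTimeIdx L M), Ω 0)) := fun x => by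
    refine mem_filter.2 ⟨mem_univ _, ?_⟩
    rw [hΦ]
    rfl
  have hterm : ∀ x : Fin 3 → SpaceTimeIdx L M,
      KLRegimeSplit.spaceTimeDist L M β (Matrix.vecCons (0 : SpaceTimeIdx L M) x i) (Matrix.vecCons (0 : SpaceTimeIdx L M) x k) *
          ‖klAnisoLegKernel L M β U μ K klE0 0 4 Ω (Matrix.vecCons (0 : SpaceTimeIdx L M) x)‖ ≤
        wt ((univ.image (Φ x)).image (latticeLegPos Ng)) *
          ‖kernel ℂ (ExteriorAlgebra.map (Matrix.toLin' E₀) (effAction ℂ C₀ (ExteriorAlgebra.map (Matrix.toLin' S) Vt))) (2 * 2) (Φ x)‖ := by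
    intro x
    have hker : klAnisoLegKernel L M β U μ K klE0 0 4 Ω (Matrix.vecCons (0 : SpaceTimeIdx L M) x) =
        kernel ℂ (ExteriorAlgebra.map (Matrix.toLin' E₀) (effAction ℂ C₀ (ExteriorAlgebra.map (Matrix.toLin' S) Vt))) (2 * 2) (Φ x) :=
      klAnisoLegKernel_zero_eq_kernel_map hβ.ne' U μ K 4 Ω _
    rw [hker]
    refine mul_le_mul_of_nonneg_right ?_ (norm_nonneg _)
    have hd := spaceTimeDist_le_gridLabelDist_latticeLegPos (Ns := sectorCount 0) hβ.le (Φ x i) (Φ x k)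
    have hd' := gridLabelDist_le_gridLabelWt_image L Ng β (latticeLegPos Ng ∘ Φ x) i k
    rw [← image_image] at hd'
    exact hd.trans hd'
  calc imagTimeWeight β M ^ 3 * ∑ x : Fin 3 → SpaceTimeIdx L M,
          KLRegimeSplit.spaceTimeDist L M β (Matrix.vecCons (0 : SpaceTimeIdx L M) x i) (Matrix.vecCons (0 : SpaceTimeIdx L M) x k) *
            ‖klAnisoLegKernel L M β U μ K klE0 0 4 Ω (Matrix.vecCons (0 : SpaceTimeIdx L M) x)‖
      ≤ imagTimeWeight β M ^ 3 * ∑ x : Fin 3 → SpaceTimeIdx L M, wt ((univ.image (Φ x)).image (latticeLegPos Ng)) *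
          ‖kernel ℂ (ExteriorAlgebra.map (Matrix.toLin' E₀) (effAction ℂ C₀ (ExteriorAlgebra.map (Matrix.toLin' S) Vt))) (2 * 2) (Φ x)‖ :=
        mul_le_mul_of_nonneg_left (sum_le_sum fun x _ => hterm x) (pow_nonneg (imagTimeWeight_nonneg hβ.le M) 3)
    _ = imagTimeWeight β M ^ 3 * ∑ X'' ∈ (univ : Finset (Fin 3 → SpaceTimeIdx L M)).image Φ, wt ((univ.image X'').image (latticeLegPos Ng)) *
          ‖kernel ℂ (ExteriorAlgebra.map (Matrix.toLin' E₀) (effAction ℂ C₀ (ExteriorAlgebra.map (Matrix.toLin' S) Vt))) (2 * 2) X''‖ := by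
        rw [sum_image fun x _ x' _ h => hΦinj h]
    _ ≤ imagTimeWeight β M ^ 3 * ∑ X'' ∈ univ.filter (fun X'' : Fin (2 * 2) → SpaceTimeIdx L M × SectorLeg (sectorCount 0) =>
          X'' (⟨0, by omega⟩ : Fin (2 * 2)) = ((0 : SpaceTimeIdx L M), Ω 0)), wt ((univ.image X'').image (latticeLegPos Ng)) *
          ‖kernel ℂ (ExteriorAlgebra.map (Matrix.toLin' E₀) (effAction ℂ C₀ (ExteriorAlgebra.map (Matrix.toLin' S) Vt))) (2 * 2) X''‖ := by
        refine mul_le_mul_of_nonneg_left (sum_le_sum_of_subset_of_nonneg (fun X'' hX'' => ?_) fun X'' _ _ =>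
          mul_nonneg (hwtree.nonneg _) (norm_nonneg _)) (pow_nonneg (imagTimeWeight_nonneg hβ.le M) 3)
        obtain ⟨x, -, rfl⟩ := mem_image.1 hX''
        exact hΦmem x
    _ ≤ _ := mul_le_mul_of_nonneg_left hstep (pow_nonneg (imagTimeWeight_nonneg hβ.le M) 3)

end Summit.HubbardSuperconductivity.HubbardSuperconductivity.Theorems.EngineV8

end
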